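import Literature.MathematicalPhysics.QuantumFieldTheory.Balaban1983to89.BlockAveraging
import Literature.Computability.QuantumComplexity.SU2ChordGeometry

/-!
# A concrete small-loop average on `SU(2)` for Bałaban's block averaging [Balaban1987RG1] (0.4): the quaternionic
# projected mean, with (0.5)–(0.7) kernel-checked and the measurability hypothesis of `BlockAveraging` discharged

Cell `pub-balaban`, T4 programme, continuation of row T4-D.L (tree `BlockAveraging`, which types the printed averaging (0.4)
of [Balaban1987RG1] as `BlockAveraging.blockAvg ℰ : Setup.Averaging P j G` over an ABSTRACT small-loop average
`ℰ : LoopAverage G` — the operation `{W_i} ↦ exp[|I|⁻¹ Σ_i log W_i]` inside (0.4), axiomatised by the paper's own (0.5)–(0.7)).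
`LoopAverage G` was shown inhabited there only by the trivial `E ≡ 1` and by the abstract `Setup.GroupAverage`s; and the
measurability discharge `FiniteEpsData.avgMeasurable_of_blockAvg` kept the hypothesis `hE : ∀ n, Measurable ℰ.E`.  This
module gives, for the group of the summit statement `G = SU(2)` (`Matrix.specialUnitaryGroup (Fin 2) ℂ` with the tree's
`GaugeGroup` / `RegularGaugeGroup` instances of `UnitaryModel`, `dist1 U = ‖U - 1‖` in the `L²`-operator norm), ONE CONCRETE,
NON-TRIVIAL, MEASURABLE inhabitant and removes that hypothesis for it.

WHAT IS QUOTED (rendered page 253 of [Balaban1987RG1]; cell READING rows C-pv26g2-3, C-pv26g2-4): "Thus we have to define an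
average of a finite set of group elements. We introduce an axiomatric definition of such an average. It is a Gᶜ-valued function
defined on sets {U_j : j = 1, 2, …, n}, U_j ∈ Gᶜ, with sufficiently small diameters. We denote it by {U_j}‾ = M({U_j}), and we
assume that it is an analytic function having the following properties: M({U_j⁻¹}) = M({U_j})⁻¹; (0.5) M({uU_jv}) = uM({U_j})v;
(0.6) M(π{U_j}) = M({U_j}) for an arbitrary permutation π of the set {U_j}; (0.7)", "if U_j ∈ G, then M({U_j}) ∈ G also. (0.9)",
"There are several proposals how to define such averages, see [74, 75, 35]." and "The considerations and results of this, and
previous papers, do not depend on any particular averaging operation used; they are valid universally for all averages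
satisfying the above properties."; p. 254: "in fact we may use many other definitions".

WHAT IS DEFINED AND PROVED (every statement kernel-checked; nothing of the manuscripts is asserted):
* §1 For a finite family `W : ι → SU(2)` the matrix `q(W) = Σ_i W_i` (`SU2Mean.qsum`) lies in the real quaternion algebra
  `ℍ = {q ∈ M₂(ℂ) : q† = adj q} = ℝ_{≥0} · SU(2)`: `star_qsum` (from the tree's `star_coe_eq_adjugate`, Cayley–Hamilton in
  dimension two), hence `q q† = q† q = det q · 1` (`qsum_mul_star`, `star_mul_qsum`), `det q` is real and `≥ 0`
  (`star_det_qsum`, `det_qsum_im`, `det_qsum_re_nonneg`) and `det q = 0 ⇒ q = 0` (`qsum_eq_zero_of_det_eq_zero`).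
* §2 The PROJECTED MEAN `SU2Mean.mean W := (det q(W))^{-1/2} q(W) ∈ SU(2)` when `det q(W) ≠ 0`, and `1` on the exceptional set
  `det q(W) = 0` (i.e. `Σ_i W_i = 0`) — as matrices `SU2Mean.projMat (q(W))` with `projMat q = (√(Re det q))⁻¹ • q` / `1`;
  membership in `SU(2)` is `projMat_qsum_mem`.  (For `SU(2) ≅ S³ ⊂ ℍ ≅ ℝ⁴` this is the normalised Euclidean barycentre — the
  "projected arithmetic mean" of the rotation-averaging literature, M. Moakher, SIAM J. Matrix Anal. Appl. 24 (2002),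
  doi:10.1137/s0895479801383877; it is NOT Bałaban's `exp[mean log]` of (0.4) nor Federbush's implicit mean (0.10): the paper
  declares the choice immaterial, quotations above; cell DIVERGENCE row D-pv26g2.4.)
* §3 The axioms: (0.7) `mean (W ∘ σ) = mean W` for every permutation (`mean_comp_perm`, unconditionally); (0.5)
  `mean (W⁻¹) = (mean W)⁻¹` (`mean_inv`, unconditionally: `q(W⁻¹) = q(W)†`); (0.6) in the printed TWO-SIDED form
  `mean (u W v) = u (mean W) v` for all `u v ∈ SU(2)` whenever `det q(W) ≠ 0` (`mean_mul_mul`; `det (u q v) = det q`), in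
  particular conjugation equivariance; NON-TRIVIALITY `mean (U, …, U) = U` (`mean_const`); and SMALLNESS ⇒ the good branch:
  if `dist1 W_i < 1` for all `i` (nonempty family) then `Re tr q(W) > |ι| > 0`, so `det q(W) ≠ 0`
  (`det_qsum_ne_zero_of_dist1_lt_one`, by the tree's chord formula `‖1 - U‖² = 2 - Re tr U`, `norm_one_sub_coe_sq`).
* §4 `su2Mean : LoopAverage SU(2)` with radius `δ = 1` (the structure of `BlockAveraging` §0), and the two-sided (0.6) for
  it on small families (`su2Mean_mul_mul`).
* §5 MEASURABILITY: `mean : (ι → SU(2)) → SU(2)` is Borel measurable for finite `ι` (`measurable_mean`): it is continuous on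
  the open set `det q(W) ≠ 0` (`continuousOn_coe_mean`) and constant on its (closed) complement
  (`ContinuousOn.measurable_piecewise`; the domain is a countable product of the second-countable Borel space `SU(2)`, tree instance
  `instSecondCountableTopologySpecialUnitaryGroup` of `YangMillsEuclidean`, so continuity gives measurability).
* §6 CONSEQUENCES for the T4 programme: for every lattice family `F` and every finite-`ε` approximation
  `D : FiniteEpsData F SU(2)` whose averaging maps ARE the block averaging with this mean (`D.av K j = blockAvg su2Mean`):
  `D.AvgMeasurable` with NO residual hypothesis (`avgMeasurable_of_blockAvgSU2`), hence — by `T4Continuum` §7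
  (`avg_limit_reflectionPositive_SU`) and `BlockAveraging` §6 (`limit_torusCovariant_of_blockAvg`) — the reflection-positivity
  and torus-covariance targets of rung (B)+1 HOLD for such `D` in both forms (`limit_rp_and_cov_of_blockAvgSU2`), and the
  four-target conjunction for such `D` follows from the existence target alone (`four_targets_of_exists_blockAvgSU2`).
  The general packaging over an arbitrary measurable `ℰ` is the business of the tree's apex module (row T4-T.L); this module
  only supplies the instance.

NOT ENCODED: `Gᶜ`-valuedness and analyticity of `M`, (0.8) (the linearisation `(1/i) log M({exp iA_j}) = n⁻¹ Σ A_j + …`;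
true for the projected mean but not proved here), Federbush's (0.10).  VALUE: a kernel inhabitant making the typed (0.4)
averaging non-vacuous and hypothesis-free on the summit group; NOT an estimate, NOT summit progress.

REVISION LOG.  v1 p179190 (unit b2b-balaban-pv26-g2).  v1.1 (unit b2b-balaban-pv26-g4; DOCFIX, docstring-only, every declaration
byte-identical to v1): the two §6 corollaries `limit_rp_and_cov_of_blockAvgSU2`, `four_targets_of_exists_blockAvgSU2` re-tagged
`[cite: Balaban1987RG1, (0.4)/(0.6) p.253]` (what they use) instead of `Thm 2 p.259` (B12 Theorem 2, the flow-control theorem, is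
used nowhere in this module) — cell GAPS G-ref2-22 (c); companions: `BlockAveragingHaarAC` v1.1 (p180996), `BlockAveragingExpMeanLog`
v1.0.1 (p181110).  Later siblings, for the reader: (0.8) for `su2Mean` is PROVED in `BlockAveragingSU2FirstOrder` (p180310), the
`Gᶜ = SL(2,ℂ)` extension with analyticity in `BlockAveragingSU2Complex` (p180434), `HaarAC` of `blockAvg su2Mean` in
`BlockAveragingHaarAC` (unit b2b-balaban-pv03); the NOT ENCODED list above is this module's own scope and is left as landed.
-/

noncomputable section

open scoped Matrix.Norms.L2Operator ComplexOrder
open MeasureTheory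

namespace Literature.MathematicalPhysics.QuantumFieldTheory.Balaban1983to89

open Literature.Computability.QuantumComplexity (adjugate_fin_two_eq_trace_smul_sub star_coe_eq_adjugate
  norm_one_sub_coe_sq)
open Literature.MathematicalPhysics.QuantumLattice (fundamentalRep fundamentalRep_apply)


namespace SU2Mean

variable {ι : Type*} [Fintype ι]

/-! ## 1. Sums of `SU(2)` matrices are quaternions -/

/-- `q(W) = Σ_i W_i ∈ M₂(ℂ)`, the (un-normalised) Euclidean barycentre of a finite family of elements of `SU(2)`. [folklore] -/
def qsum (W : ι → Matrix.specialUnitaryGroup (Fin 2) ℂ) : Matrix (Fin 2) (Fin 2) ℂ := ∑ i, (W i : Matrix (Fin 2) (Fin 2) ℂ)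

/-- `q(W)† = adj q(W)`: a sum of special unitary `2 × 2` matrices is a (real) quaternion. [folklore] -/
theorem star_qsum (W : ι → Matrix.specialUnitaryGroup (Fin 2) ℂ) : star (qsum W) = Matrix.adjugate (qsum W) := by
  unfold qsum
  rw [star_sum, adjugate_fin_two_eq_trace_smul_sub, Matrix.trace_sum, Finset.sum_smul, ← Finset.sum_sub_distrib]
  refine Finset.sum_congr rfl fun i _ => ?_
  rw [star_coe_eq_adjugate, adjugate_fin_two_eq_trace_smul_sub]

/-- `q q† = det q · 1`. [folklore] -/
theorem qsum_mul_star (W : ι → Matrix.specialUnitaryGroup (Fin 2) ℂ) :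
    qsum W * star (qsum W) = (qsum W).det • (1 : Matrix (Fin 2) (Fin 2) ℂ) := by
  rw [star_qsum, Matrix.mul_adjugate]

/-- `q† q = det q · 1`. [folklore] -/
theorem star_mul_qsum (W : ι → Matrix.specialUnitaryGroup (Fin 2) ℂ) :
    star (qsum W) * qsum W = (qsum W).det • (1 : Matrix (Fin 2) (Fin 2) ℂ) := by
  rw [star_qsum, Matrix.adjugate_mul]

/-- `det q(W)` is real: `conj (det q) = det q`. [folklore] -/
theorem star_det_qsum (W : ι → Matrix.specialUnitaryGroup (Fin 2) ℂ) : star (qsum W).det = (qsum W).det := by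
  have h := congrArg Matrix.det (star_qsum W)
  rw [Matrix.star_eq_conjTranspose, Matrix.det_conjTranspose, Matrix.det_adjugate] at h
  simpa using h

/-- `Im det q(W) = 0`. [folklore] -/
theorem det_qsum_im (W : ι → Matrix.specialUnitaryGroup (Fin 2) ℂ) : ((qsum W).det).im = 0 := by
  have h := congrArg Complex.im (star_det_qsum W)
  rw [Complex.star_def, Complex.conj_im] at h
  linarith

/-- `det q(W)` as the real number `Re det q(W)`. [folklore] -/
theorem det_qsum_eq_ofReal (W : ι → Matrix.specialUnitaryGroup (Fin 2) ℂ) : (qsum W).det = ((((qsum W).det).re : ℝ) : ℂ) := by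
  apply Complex.ext <;> simp [det_qsum_im]

/-- `Re det q(W) ≥ 0` (it is `|q₀₀|² + |q₀₁|²`). [folklore] -/
theorem det_qsum_re_nonneg (W : ι → Matrix.specialUnitaryGroup (Fin 2) ℂ) : 0 ≤ ((qsum W).det).re := by
  have h := congrFun (congrFun (qsum_mul_star W) 0) 0
  rw [Matrix.mul_apply, Matrix.smul_apply, Matrix.one_apply_eq, smul_eq_mul, mul_one] at h
  rw [← h, Complex.re_sum]
  refine Finset.sum_nonneg fun j _ => ?_
  rw [Matrix.star_apply, Complex.star_def, Complex.mul_conj, Complex.ofReal_re]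
  exact Complex.normSq_nonneg _

/-- `det q(W) = 0 ⇒ q(W) = 0` (`q† q = det q · 1` and `A† A = 0 ⇒ A = 0` over `ℂ`). [folklore] -/
theorem qsum_eq_zero_of_det_eq_zero (W : ι → Matrix.specialUnitaryGroup (Fin 2) ℂ) (h : (qsum W).det = 0) : qsum W = 0 := by
  have h1 := star_mul_qsum W
  rw [h, zero_smul, Matrix.star_eq_conjTranspose] at h1
  exact Matrix.conjTranspose_mul_self_eq_zero.1 h1

/-- Off the exceptional set, `Re det q(W) > 0`. [folklore] -/
theorem det_qsum_re_pos (W : ι → Matrix.specialUnitaryGroup (Fin 2) ℂ) (h : (qsum W).det ≠ 0) : 0 < ((qsum W).det).re := by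
  rcases (det_qsum_re_nonneg W).lt_or_eq with hlt | heq
  · exact hlt
  · exact absurd (by rw [det_qsum_eq_ofReal W, ← heq, Complex.ofReal_zero]) h

/-- `q(W ∘ σ) = q(W)` for a permutation `σ` of the indices. [folklore] -/
theorem qsum_comp_perm (W : ι → Matrix.specialUnitaryGroup (Fin 2) ℂ) (σ : Equiv.Perm ι) : qsum (W ∘ σ) = qsum W := by
  unfold qsum
  exact Equiv.sum_comp σ (fun i => (W i : Matrix (Fin 2) (Fin 2) ℂ))

/-- `q(W⁻¹) = q(W)†` (in `SU(2)` the inverse is the adjoint). [folklore] -/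
theorem qsum_inv (W : ι → Matrix.specialUnitaryGroup (Fin 2) ℂ) : qsum (fun i => (W i)⁻¹) = star (qsum W) := by
  unfold qsum
  rw [star_sum]
  rfl

/-- `q(u W v) = u q(W) v`. [folklore] -/
theorem qsum_mul_mul (u v : Matrix.specialUnitaryGroup (Fin 2) ℂ) (W : ι → Matrix.specialUnitaryGroup (Fin 2) ℂ) :
    qsum (fun i => u * W i * v) = (u : Matrix (Fin 2) (Fin 2) ℂ) * qsum W * (v : Matrix (Fin 2) (Fin 2) ℂ) := by
  unfold qsum
  rw [Finset.mul_sum, Finset.sum_mul]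
  rfl

/-- `q(U, …, U) = |ι| · U`. [folklore] -/
theorem qsum_const (U : Matrix.specialUnitaryGroup (Fin 2) ℂ) :
    qsum (fun _ : ι => U) = (Fintype.card ι : ℂ) • (U : Matrix (Fin 2) (Fin 2) ℂ) := by
  unfold qsum
  rw [Finset.sum_const, Finset.card_univ, ← Nat.cast_smul_eq_nsmul ℂ]

/-! ## 2. The projected mean -/

/-- Scalar normalisation of a `2 × 2` complex matrix to determinant one by the positive square root of `Re det`:
`projMat q = (√(Re det q))⁻¹ • q` if `det q ≠ 0`, and `1` if `det q = 0`. [folklore] -/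
def projMat (q : Matrix (Fin 2) (Fin 2) ℂ) : Matrix (Fin 2) (Fin 2) ℂ :=
  if q.det = 0 then 1 else (((Real.sqrt q.det.re)⁻¹ : ℝ) : ℂ) • q

/-- The good branch. [folklore] -/
theorem projMat_of_ne {q : Matrix (Fin 2) (Fin 2) ℂ} (h : q.det ≠ 0) :
    projMat q = (((Real.sqrt q.det.re)⁻¹ : ℝ) : ℂ) • q := if_neg h

/-- The exceptional branch. [folklore] -/
theorem projMat_of_eq {q : Matrix (Fin 2) (Fin 2) ℂ} (h : q.det = 0) : projMat q = 1 := if_pos h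

/-- `projMat (q†) = (projMat q)†` for every `q` (the scalar is real and `det q† = conj det q`). [folklore] -/
theorem projMat_star (q : Matrix (Fin 2) (Fin 2) ℂ) : projMat (star q) = star (projMat q) := by
  have hd : (star q).det = star q.det := by rw [Matrix.star_eq_conjTranspose, Matrix.det_conjTranspose]
  have hre : (star q).det.re = q.det.re := by rw [hd, Complex.star_def, Complex.conj_re]
  by_cases h : q.det = 0
  · rw [projMat_of_eq h, projMat_of_eq (by rw [hd, h, star_zero]), star_one]
  · have h' : (star q).det ≠ 0 := by rwa [hd, star_ne_zero]
    rw [projMat_of_ne h, projMat_of_ne h', hre, star_smul, Complex.star_def, Complex.conj_ofReal]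

/-- `projMat (u q v) = u (projMat q) v` when `det u = det v = 1` and `det q ≠ 0`. [folklore] -/
theorem projMat_mul_mul {u v q : Matrix (Fin 2) (Fin 2) ℂ} (hu : u.det = 1) (hv : v.det = 1) (h : q.det ≠ 0) :
    projMat (u * q * v) = u * projMat q * v := by
  have hd : (u * q * v).det = q.det := by rw [Matrix.det_mul, Matrix.det_mul, hu, hv, one_mul, mul_one]
  rw [projMat_of_ne h, projMat_of_ne (by rwa [hd]), hd, Matrix.mul_smul, Matrix.smul_mul]

/-- On quaternions the normalisation lands in `SU(2)`: `projMat (q(W)) ∈ SU(2)`. [folklore] -/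
theorem projMat_qsum_mem (W : ι → Matrix.specialUnitaryGroup (Fin 2) ℂ) :
    projMat (qsum W) ∈ Matrix.specialUnitaryGroup (Fin 2) ℂ := by
  by_cases h : (qsum W).det = 0
  · rw [projMat_of_eq h]; exact one_mem _
  · have hpos := det_qsum_re_pos W h
    set c : ℝ := (Real.sqrt ((qsum W).det).re)⁻¹ with hc
    have hcc : (c : ℂ) * (c : ℂ) * (qsum W).det = 1 := by
      rw [det_qsum_eq_ofReal W, ← Complex.ofReal_mul, ← Complex.ofReal_mul, ← Complex.ofReal_one, Complex.ofReal_inj, hc,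
        ← mul_inv, Real.mul_self_sqrt hpos.le, inv_mul_cancel₀ hpos.ne']
    rw [projMat_of_ne h, Matrix.mem_specialUnitaryGroup_iff, Matrix.mem_unitaryGroup_iff]
    refine ⟨?_, ?_⟩
    · rw [star_smul, Complex.star_def, Complex.conj_ofReal, smul_mul_smul_comm, qsum_mul_star, smul_smul, hcc, one_smul]
    · rw [Matrix.det_smul, Fintype.card_fin, pow_two, hcc]

/-- **The quaternionic projected mean** `mean W = (det Σ_i W_i)^{-1/2} Σ_i W_i ∈ SU(2)` (value `1` on the exceptional set
`Σ_i W_i = 0`). [folklore] -/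
def mean (W : ι → Matrix.specialUnitaryGroup (Fin 2) ℂ) : Matrix.specialUnitaryGroup (Fin 2) ℂ :=
  ⟨projMat (qsum W), projMat_qsum_mem W⟩

/-- The matrix of `mean W`. [folklore] -/
@[simp] theorem coe_mean (W : ι → Matrix.specialUnitaryGroup (Fin 2) ℂ) :
    (mean W : Matrix (Fin 2) (Fin 2) ℂ) = projMat (qsum W) := rfl

/-! ## 3. The axioms (0.5)–(0.7), non-triviality, and the small-field branch -/

/-- (0.7) PERMUTATION INVARIANCE, unconditionally. [cite: Balaban1987RG1, (0.7) p.253] -/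
theorem mean_comp_perm (W : ι → Matrix.specialUnitaryGroup (Fin 2) ℂ) (σ : Equiv.Perm ι) : mean (W ∘ σ) = mean W :=
  Subtype.ext (by rw [coe_mean, coe_mean, qsum_comp_perm])

/-- (0.5) INVERSION, unconditionally: `mean (W⁻¹) = (mean W)⁻¹`. [cite: Balaban1987RG1, (0.5) p.253] -/
theorem mean_inv (W : ι → Matrix.specialUnitaryGroup (Fin 2) ℂ) : mean (fun i => (W i)⁻¹) = (mean W)⁻¹ :=
  Subtype.ext (by rw [coe_mean, qsum_inv, projMat_star]; rfl)

/-- (0.6) TWO-SIDED EQUIVARIANCE `mean (u W v) = u (mean W) v` off the exceptional set. [cite: Balaban1987RG1, (0.6) p.253] -/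
theorem mean_mul_mul (u v : Matrix.specialUnitaryGroup (Fin 2) ℂ) (W : ι → Matrix.specialUnitaryGroup (Fin 2) ℂ)
    (h : (qsum W).det ≠ 0) :
    mean (fun i => u * W i * v) = u * mean W * v :=
  Subtype.ext (by
    rw [coe_mean, qsum_mul_mul, projMat_mul_mul (Matrix.mem_specialUnitaryGroup_iff.1 u.2).2
      (Matrix.mem_specialUnitaryGroup_iff.1 v.2).2 h]
    rfl)

/-- (0.6) for conjugations: `mean (u W u⁻¹) = u (mean W) u⁻¹` off the exceptional set. [cite: Balaban1987RG1, (0.6) p.253] -/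
theorem mean_conj (u : Matrix.specialUnitaryGroup (Fin 2) ℂ) (W : ι → Matrix.specialUnitaryGroup (Fin 2) ℂ)
    (h : (qsum W).det ≠ 0) :
    mean (fun i => u * W i * u⁻¹) = u * mean W * u⁻¹ :=
  mean_mul_mul u u⁻¹ W h

/-- NON-TRIVIALITY: the mean of a constant nonempty family is the constant, `mean (U, …, U) = U`. [folklore] -/
theorem mean_const [Nonempty ι] (U : Matrix.specialUnitaryGroup (Fin 2) ℂ) : mean (fun _ : ι => U) = U := by
  have hU := Matrix.mem_specialUnitaryGroup_iff.1 U.2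
  have hn : (0 : ℝ) < Fintype.card ι := Nat.cast_pos.2 Fintype.card_pos
  have hdet : (qsum (fun _ : ι => U)).det = (((Fintype.card ι : ℝ) * Fintype.card ι : ℝ) : ℂ) := by
    rw [qsum_const, Matrix.det_smul, hU.2, mul_one, Fintype.card_fin]; push_cast; ring
  have hne : (qsum (fun _ : ι => U)).det ≠ 0 := by
    rw [hdet, Complex.ofReal_ne_zero]; positivity
  apply Subtype.ext
  rw [coe_mean, projMat_of_ne hne, hdet, Complex.ofReal_re, Real.sqrt_mul_self hn.le, qsum_const, smul_smul,
    ← Complex.ofReal_natCast, ← Complex.ofReal_mul, inv_mul_cancel₀ hn.ne', Complex.ofReal_one, one_smul]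

/-- The tree's `dist1` on `SU(2)` (instance `UnitaryModel.instGaugeGroupSpecialUnitaryGroup`) is the operator-norm distance
to `1`. [cite: Balaban1985Averaging, (19) p.21] -/
theorem dist1_eq_norm (U : Matrix.specialUnitaryGroup (Fin 2) ℂ) : dist1 U = ‖(U : Matrix (Fin 2) (Fin 2) ℂ) - 1‖ := rfl

/-- SMALL FIELDS: `dist1 U < 1 ⇒ Re tr U > 1` in `SU(2)` (chord formula `‖1 - U‖² = 2 - Re tr U`). [folklore] -/
theorem one_lt_trace_re_of_dist1_lt_one (U : Matrix.specialUnitaryGroup (Fin 2) ℂ) (h : dist1 U < 1) :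
    1 < ((U : Matrix (Fin 2) (Fin 2) ℂ).trace).re := by
  have e := norm_one_sub_coe_sq U
  have hn : ‖(1 : Matrix (Fin 2) (Fin 2) ℂ) - (U : Matrix (Fin 2) (Fin 2) ℂ)‖ < 1 := by rwa [norm_sub_rev, ← dist1_eq_norm]
  have h2 : ‖(1 : Matrix (Fin 2) (Fin 2) ℂ) - (U : Matrix (Fin 2) (Fin 2) ℂ)‖ ^ 2 < 1 := by
    nlinarith [norm_nonneg ((1 : Matrix (Fin 2) (Fin 2) ℂ) - (U : Matrix (Fin 2) (Fin 2) ℂ))]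
  linarith

/-- SMALL FIELDS AVOID THE EXCEPTIONAL SET: if every `W_i` is within `dist1 < 1` of `1` (nonempty family) then
`det q(W) ≠ 0`, since `Re tr q(W) > |ι| > 0` forbids `q(W) = 0`. [folklore] -/
theorem det_qsum_ne_zero_of_dist1_lt_one [Nonempty ι] (W : ι → Matrix.specialUnitaryGroup (Fin 2) ℂ) (h : ∀ i, dist1 (W i) < 1) :
    (qsum W).det ≠ 0 := by
  intro hd
  have hq := qsum_eq_zero_of_det_eq_zero W hd
  have htr : ((qsum W).trace).re = ∑ i, ((W i : Matrix (Fin 2) (Fin 2) ℂ).trace).re := by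
    unfold qsum; rw [Matrix.trace_sum, Complex.re_sum]
  have hpos : 0 < ∑ i, ((W i : Matrix (Fin 2) (Fin 2) ℂ).trace).re :=
    Finset.sum_pos (fun i _ => lt_trans one_pos (one_lt_trace_re_of_dist1_lt_one (W i) (h i))) Finset.univ_nonempty
  rw [← htr, hq, Matrix.trace_zero, Complex.zero_re] at hpos
  exact lt_irrefl _ hpos

/-- Hence (0.6) two-sided on small families. [cite: Balaban1987RG1, (0.6) p.253] -/
theorem mean_mul_mul_of_small [Nonempty ι] (u v : Matrix.specialUnitaryGroup (Fin 2) ℂ)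
    (W : ι → Matrix.specialUnitaryGroup (Fin 2) ℂ) (h : ∀ i, dist1 (W i) < 1) :
    mean (fun i => u * W i * v) = u * mean W * v :=
  mean_mul_mul u v W (det_qsum_ne_zero_of_dist1_lt_one W h)

end SU2Mean

/-! ## 4. The `LoopAverage` instance -/

/-- **`su2Mean`**: the quaternionic projected mean as a small-loop average on `SU(2)` in the sense of `BlockAveraging` §0
(B12 (0.5)–(0.7) on families within `dist1 < 1` of `1`; here (0.5) and (0.7) hold everywhere and (0.6) two-sidedly on the
small families). [cite: Balaban1987RG1, (0.5) p.253] -/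
def su2Mean : LoopAverage (Matrix.specialUnitaryGroup (Fin 2) ℂ) where
  δ := 1
  δ_pos := one_pos
  E := fun W => SU2Mean.mean W
  inv := fun W _ => SU2Mean.mean_inv W
  conj := fun W hW u => SU2Mean.mean_mul_mul_of_small u u⁻¹ W hW
  perm := fun W _ σ => SU2Mean.mean_comp_perm W σ

/-- `su2Mean.E = SU2Mean.mean`. [folklore] -/
@[simp] theorem su2Mean_E {n : ℕ} (W : Fin (n+1) → Matrix.specialUnitaryGroup (Fin 2) ℂ) : su2Mean.E W = SU2Mean.mean W := rfl

/-- `su2Mean.δ = 1`. [folklore] -/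
@[simp] theorem su2Mean_δ : su2Mean.δ = 1 := rfl

/-- The printed two-sided (0.6) for `su2Mean` on its small families (more than the structure field `LoopAverage.conj` records).
[cite: Balaban1987RG1, (0.6) p.253] -/
theorem su2Mean_mul_mul {n : ℕ} (W : Fin (n+1) → Matrix.specialUnitaryGroup (Fin 2) ℂ)
    (hW : ∀ i, dist1 (W i) < su2Mean.δ) (u v : Matrix.specialUnitaryGroup (Fin 2) ℂ) :
    su2Mean.E (fun i => u * W i * v) = u * su2Mean.E W * v :=
  SU2Mean.mean_mul_mul_of_small u v W hW

/-- `su2Mean` is not the trivial average: on constant families it returns the constant. [folklore] -/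
theorem su2Mean_const {n : ℕ} (U : Matrix.specialUnitaryGroup (Fin 2) ℂ) :
    su2Mean.E (fun _ : Fin (n+1) => U) = U := SU2Mean.mean_const U

/-! ## 5. Measurability -/

namespace SU2Mean

variable {ι : Type*} [Fintype ι]

/-- `W ↦ q(W)` is continuous. [folklore] -/
theorem continuous_qsum : Continuous (qsum : (ι → Matrix.specialUnitaryGroup (Fin 2) ℂ) → Matrix (Fin 2) (Fin 2) ℂ) := by
  unfold qsum
  exact continuous_finsetSum _ fun i _ => continuous_subtype_val.comp (continuous_apply i)

/-- The exceptional set `{W : det q(W) = 0}` is closed. [folklore] -/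
theorem isClosed_exceptional : IsClosed {W : ι → Matrix.specialUnitaryGroup (Fin 2) ℂ | (qsum W).det = 0} :=
  isClosed_eq (continuous_qsum (ι := ι)).matrix_det continuous_const

/-- Off the exceptional set the mean is continuous (as a matrix-valued map). [folklore] -/
theorem continuousOn_coe_mean :
    ContinuousOn (fun W : ι → Matrix.specialUnitaryGroup (Fin 2) ℂ => (mean W : Matrix (Fin 2) (Fin 2) ℂ))
      {W | (qsum W).det ≠ 0} := by
  have e : Set.EqOn (fun W : ι → Matrix.specialUnitaryGroup (Fin 2) ℂ => (mean W : Matrix (Fin 2) (Fin 2) ℂ))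
      (fun W => (((Real.sqrt ((qsum W).det).re)⁻¹ : ℝ) : ℂ) • qsum W) {W | (qsum W).det ≠ 0} :=
    fun W hW => by simp only [coe_mean, projMat_of_ne (show (qsum W).det ≠ 0 from hW)]
  have hc : ContinuousOn (fun W : ι → Matrix.specialUnitaryGroup (Fin 2) ℂ => (((Real.sqrt ((qsum W).det).re)⁻¹ : ℝ) : ℂ))
      {W | (qsum W).det ≠ 0} := by
    refine Complex.continuous_ofReal.comp_continuousOn (ContinuousOn.inv₀ ?_ fun W hW => ?_)
    · exact (Complex.continuous_re.comp (continuous_qsum (ι := ι)).matrix_det).sqrt.continuousOn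
    · exact (Real.sqrt_pos.2 (det_qsum_re_pos W hW)).ne'
  exact (hc.smul (continuous_qsum (ι := ι)).continuousOn).congr e

/-- Off the exceptional set the mean is continuous (as an `SU(2)`-valued map). [folklore] -/
theorem continuousOn_mean :
    ContinuousOn (mean : (ι → Matrix.specialUnitaryGroup (Fin 2) ℂ) → Matrix.specialUnitaryGroup (Fin 2) ℂ)
      {W | (qsum W).det ≠ 0} :=
  Topology.IsInducing.subtypeVal.continuousOn_iff.2 continuousOn_coe_mean

/-- **MEASURABILITY of the projected mean** `mean : (ι → SU(2)) → SU(2)` (Borel structures; product σ-algebra on the domain),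
for every finite index type. [folklore] -/
theorem measurable_mean :
    Measurable (mean : (ι → Matrix.specialUnitaryGroup (Fin 2) ℂ) → Matrix.specialUnitaryGroup (Fin 2) ℂ) := by
  classical
  set s : Set (ι → Matrix.specialUnitaryGroup (Fin 2) ℂ) := {W | (qsum W).det ≠ 0} with hs_def
  have hs : MeasurableSet s := by
    have : s = {W : ι → Matrix.specialUnitaryGroup (Fin 2) ℂ | (qsum W).det = 0}ᶜ := by ext W; simp [hs_def]
    rw [this]
    exact isClosed_exceptional.measurableSet.compl
  have hpw : Measurable (s.piecewise (mean : (ι → Matrix.specialUnitaryGroup (Fin 2) ℂ) → Matrix.specialUnitaryGroup (Fin 2) ℂ)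
      fun _ => 1) :=
    ContinuousOn.measurable_piecewise continuousOn_mean continuousOn_const hs
  have heq : s.piecewise (mean : (ι → Matrix.specialUnitaryGroup (Fin 2) ℂ) → Matrix.specialUnitaryGroup (Fin 2) ℂ) (fun _ => 1) =
      mean := by
    funext W
    by_cases hW : W ∈ s
    · exact Set.piecewise_eq_of_mem _ _ _ hW
    · rw [Set.piecewise_eq_of_notMem _ _ _ hW]
      have hW' : (qsum W).det = 0 := by simpa [hs_def] using hW
      exact (Subtype.ext (by rw [coe_mean, projMat_of_eq hW']; rfl) : (1 : Matrix.specialUnitaryGroup (Fin 2) ℂ) = mean W)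
  rwa [heq] at hpw

end SU2Mean

/-- `su2Mean.E` is measurable in every arity — the hypothesis `hE` of `FiniteEpsData.avgMeasurable_of_blockAvg`. [folklore] -/
theorem measurable_su2Mean_E (n : ℕ) : Measurable (fun W : Fin (n+1) → Matrix.specialUnitaryGroup (Fin 2) ℂ => su2Mean.E W) :=
  SU2Mean.measurable_mean

/-! ## 6. Consequences for finite-`ε` data block-averaged by `su2Mean` -/

namespace T4Continuum.FiniteEpsData

variable {F : T4Family}

/-- **`AvgMeasurable` WITH NO RESIDUAL HYPOTHESIS** for finite-`ε` data on `SU(2)` whose averaging maps are Bałaban's block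
averaging (0.4) with the projected mean. [cite: Balaban1987RG1, (0.4) p.253] -/
theorem avgMeasurable_of_blockAvgSU2 (D : FiniteEpsData F (Matrix.specialUnitaryGroup (Fin 2) ℂ))
    (h : ∀ K j, D.av K j = BlockAveraging.blockAvg su2Mean) :
    D.AvgMeasurable :=
  D.avgMeasurable_of_blockAvg su2Mean measurable_su2Mean_E h

/-- Hence the REFLECTION-POSITIVITY and TORUS-COVARIANCE targets of rung (B)+1 HOLD, in both forms, for such data
(`T4Continuum.avg_limit_reflectionPositive_SU` + `BlockAveraging.limit_torusCovariant_of_blockAvg`); what is USED of print is the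
averaging formula (0.4) (shape) and the equivariance axiom (0.6) of p. 253 — B12 Theorem 2 p. 259 is NOT used (these data are the
STUB at which (B) fails, see the apex modules). [cite: Balaban1987RG1, (0.4)/(0.6) p.253] -/
theorem limit_rp_and_cov_of_blockAvgSU2 (D : FiniteEpsData F (Matrix.specialUnitaryGroup (Fin 2) ℂ))
    (h : ∀ K j, D.av K j = BlockAveraging.blockAvg su2Mean) :
    (D.limit_reflectionPositive' ∧ D.limit_reflectionPositive) ∧ (D.limit_torusCovariant' ∧ D.limit_torusCovariant) :=
  ⟨D.avg_limit_reflectionPositive_SU (D.avgMeasurable_of_blockAvgSU2 h), D.limit_torusCovariant_of_blockAvg su2Mean h⟩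

/-- And the FOUR print-faithful targets for such data follow from the EXISTENCE target alone (uniqueness from existence by
`limit_unique'_of_limit_exists'`); Theorem 2 p. 259 is NOT used. [cite: Balaban1987RG1, (0.4)/(0.6) p.253] -/
theorem four_targets_of_exists_blockAvgSU2 (D : FiniteEpsData F (Matrix.specialUnitaryGroup (Fin 2) ℂ))
    (h : ∀ K j, D.av K j = BlockAveraging.blockAvg su2Mean)
    (hex : D.ym4_torus_continuum_limit_exists') :
    D.ym4_torus_continuum_limit_exists' ∧ D.ym4_torus_continuum_limit_unique' ∧
      D.limit_reflectionPositive' ∧ D.limit_torusCovariant' :=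
  ⟨hex, D.limit_unique'_of_limit_exists' hex, (D.limit_rp_and_cov_of_blockAvgSU2 h).1.1,
    (D.limit_rp_and_cov_of_blockAvgSU2 h).2.1⟩

end T4Continuum.FiniteEpsData

end Literature.MathematicalPhysics.QuantumFieldTheory.Balaban1983to89
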